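import Literature.NumberTheory.EllipticCurves.Kato2004.IwasawaH1CoeffTorsionFreeProofs
import Literature.NumberTheory.EllipticCurves.Kato2004.IwasawaCohomologyCoeffExistsProofs
import Mathlib.RingTheory.Polynomial.Resultant.Basic
import Mathlib.FieldTheory.Minpoly.IsIntegrallyClosed
import Mathlib.FieldTheory.IsAlgClosed.Basic
import HarnessLib

/-!
# The coefficient ring `𝒪 = padicCoeffIntegers S` of a finite `ℚ_p(S)/ℚ_p` along the `ℤ_p`-tower:
# a complete DVR with `(p) = 𝔪^e`, `p`-adic completeness of `𝒪ⁿ`, and the resultant dichotomy for a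
# monic `P ∈ 𝒪[X]` against `ω_n = (X+1)^{p^n} − 1` (proofs only)

Topic `NumberTheory/EllipticCurves`, sub-directory `Kato2004` (namespace = path).  THEOREMS ONLY.  Ring-
theoretic inputs of the `Λ_𝒪`-assembly of Kato's Thm. 12.4 (2) (clause "`𝐇¹(T)` is a torsion free
`Λ`-module", print leaf K0b `Kato2004.thm12_4_newform`) carried out in the sibling file
`IwasawaH1CoeffNewformLambdaTorsionProofs`; seat `bsd-wall-tp2-p2x-w2` g23.  For
`𝒪 = padicCoeffIntegers S` with `ℚ_p(S)/ℚ_p` finite: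

* `isDiscreteValuationRing_padicCoeffIntegers`, `exists_maximalIdeal_pow_eq_span_natCast` — `𝒪` is a
  DVR and `(p) = 𝔪^e`, `e ≥ 1`;
* `exists_limit_of_pow_natCast_smul`, `eq_zero_of_forall_pow_natCast_smul` — `𝒪ⁿ` is `p`-adically
  complete and separated, in the element-wise form consumed by the tower engine
  (`IwasawaH1CoeffTowerEngineProofs`: hypotheses `hprec`, `hhaus`);
* `exists_mul_add_mul_eq_C_pow_or_exists_root` — for `P` monic of positive degree and each `n`: either
  the ideal `(P, ω_n) ⊆ 𝒪[X]` contains a power of `p` (resultant, Mathlib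
  `exists_mul_add_mul_eq_C_resultant`), or `P` and `ω_n` have a common root in `ℚ̄_p`;
* `exists_monic_dvd_of_root` — a common root gives a common monic factor `minpoly_𝒪(a)` of positive
  degree (`𝒪` integrally closed, Mathlib `minpoly.isIntegrallyClosed_dvd`).

No arithmetic content; BSD is not advanced by this file.

## References

* [NeukirchANT1999] J. Neukirch, *Algebraic Number Theory* (1999), Ch. II (4.8).
* [Matsumura1987] H. Matsumura, *Commutative Ring Theory* (1987), Thm. 8.7, 8.10, 8.15.
* [Lang2002] S. Lang, *Algebra*, GTM 211 (2002), IV §2, IV §8, VII §1.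
-/

noncomputable section

open scoped NumberField
open Field CategoryTheory Topology Polynomial
open Literature.NumberTheory.GaloisRepresentations
open Literature.NumberTheory.EllipticCurves Literature.NumberTheory.EllipticCurves.Kato2004
open Literature.NumberTheory.EllipticCurves.Kato2004.EulerSystemValues

namespace Literature.NumberTheory.EllipticCurves.Kato2004

namespace IwasawaH1CoeffTorsionFree

/-! ## §1 The coefficient ring `𝒪`: a complete DVR with `(p) = 𝔪^e`; `𝒪ⁿ` is `p`-adically complete -/

section Ring

variable {p : ℕ} [Fact p.Prime] (S : Set (PadicAlgCl p)) [FiniteDimensional ℚ_[p] (padicCoeffField S)]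

/-- **`𝒪 = padicCoeffIntegers S` is a discrete valuation ring** for `ℚ_p(S)/ℚ_p` finite: a principal
ideal domain (`isPrincipalIdealRing_padicCoeffIntegers`), local, and not a field since `p ∈ 𝔪` is
non-zero (Neukirch Ch. II (4.8); Serre, *Local Fields* II §2 Prop. 3). [cite: NeukirchANT1999, Ch. II (4.8)] -/
theorem isDiscreteValuationRing_padicCoeffIntegers :
    IsDiscreteValuationRing (padicCoeffIntegers S) := by
  haveI : IsPrincipalIdealRing (padicCoeffIntegers S) := isPrincipalIdealRing_padicCoeffIntegers S
  haveI : IsLocalRing (padicCoeffIntegers S) := isLocalRing_padicCoeffIntegers S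
  refine { not_a_field' := fun h ↦ ?_ }
  have hp := IwasawaH1CoeffExists.natCast_mem_maximalIdeal_padicCoeffIntegers p S
  rw [h, Ideal.mem_bot] at hp
  exact (Fact.out : p.Prime).ne_zero (by exact_mod_cast hp)

/-- **`(p) = 𝔪^e` with `e ≥ 1`** (the ramification index of `ℚ_p(S)/ℚ_p`): every non-zero ideal of the
DVR `𝒪` is a power of `𝔪`, and `p ∈ 𝔪` is not a unit. [cite: NeukirchANT1999, Ch. II (4.8)] -/
theorem exists_maximalIdeal_pow_eq_span_natCast [IsLocalRing (padicCoeffIntegers S)] :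
    ∃ e : ℕ, 0 < e ∧
      IsLocalRing.maximalIdeal (padicCoeffIntegers S) ^ e = Ideal.span {((p : ℕ) : padicCoeffIntegers S)} := by
  haveI := isDiscreteValuationRing_padicCoeffIntegers S
  obtain ⟨ϖ, hϖ⟩ := IsDiscreteValuationRing.exists_irreducible (padicCoeffIntegers S)
  have hp0 : Ideal.span {((p : ℕ) : padicCoeffIntegers S)} ≠ ⊥ := by
    rw [Ne, Ideal.span_singleton_eq_bot]
    exact_mod_cast (Fact.out : p.Prime).ne_zero
  obtain ⟨e, he⟩ := IsDiscreteValuationRing.ideal_eq_span_pow_irreducible hp0 hϖ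
  refine ⟨e, Nat.pos_of_ne_zero ?_, by rw [hϖ.maximalIdeal_eq, Ideal.span_singleton_pow, ← he]⟩
  rintro rfl
  rw [pow_zero, Ideal.span_singleton_one, Ideal.span_singleton_eq_top] at he
  exact (IsLocalRing.mem_maximalIdeal _).mp
    (IwasawaH1CoeffExists.natCast_mem_maximalIdeal_padicCoeffIntegers p S) he

/-- `x ≡ y [SMOD I^k • ⊤]` in the ring itself is `x − y ∈ I^k`. [folklore] -/
private theorem smodEq_smul_top_iff {R : Type*} [CommRing R] (I : Ideal R) (k : ℕ) (x y : R) :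
    x ≡ y [SMOD (I ^ k • ⊤ : Submodule R R)] ↔ x - y ∈ I ^ k := by
  rw [SModEq.sub_mem, smul_eq_mul, Ideal.mul_top]

omit [FiniteDimensional ℚ_[p] (padicCoeffField S)] in
/-- Telescoping a `p`-adically Cauchy sequence: `f k' − f k ∈ p^k M` for `k ≤ k'`. [folklore] -/
private theorem exists_pow_smul_eq_sub_of_le {M' : Type*} [AddCommGroup M'] [Module (padicCoeffIntegers S) M']
    (f : ℕ → M') (hf : ∀ k, ∃ t : M', ((p : ℕ) : padicCoeffIntegers S) ^ k • t = f (k + 1) - f k)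
    {k k' : ℕ} (hkk' : k ≤ k') : ∃ t : M', ((p : ℕ) : padicCoeffIntegers S) ^ k • t = f k' - f k := by
  induction k', hkk' using Nat.le_induction with
  | base => exact ⟨0, by rw [smul_zero, sub_self]⟩
  | succ k' hkk' ih =>
    obtain ⟨t₁, ht₁⟩ := ih
    obtain ⟨t₂, ht₂⟩ := hf k'
    refine ⟨t₁ + ((p : ℕ) : padicCoeffIntegers S) ^ (k' - k) • t₂, ?_⟩
    rw [smul_add, smul_smul, ← pow_add, Nat.add_sub_cancel' hkk', ht₁, ht₂]
    abel

/-- **`𝒪ⁿ` is `p`-adically complete (element-wise form):** a sequence `f` with `f(k+1) − f(k) ∈ p^k 𝒪ⁿ`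
has a limit `L` with `f(k) − L ∈ p^k 𝒪ⁿ` for all `k`.  Coordinatewise `𝔪`-adic limits exist
(`isAdicComplete_maximalIdeal_padicCoeffIntegers`, Matsumura 8.7/8.15), and `𝔪^{ek} = (p^k)` converts
`𝔪`-adic to `p`-adic precision (read the limit off the term `f(ek)`).  This is the `hprec` input of the
tower engine. [cite: Matsumura1987, Thm. 8.7 and Thm. 8.15] -/
theorem exists_limit_of_pow_natCast_smul (n : ℕ) (f : ℕ → (Fin n → padicCoeffIntegers S))
    (hf : ∀ k, ∃ t : Fin n → padicCoeffIntegers S,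
      ((p : ℕ) : padicCoeffIntegers S) ^ k • t = f (k + 1) - f k) :
    ∃ L : Fin n → padicCoeffIntegers S, ∀ k, ∃ t : Fin n → padicCoeffIntegers S,
      ((p : ℕ) : padicCoeffIntegers S) ^ k • t = f k - L := by
  haveI : IsLocalRing (padicCoeffIntegers S) := isLocalRing_padicCoeffIntegers S
  haveI := IwasawaH1CoeffExists.isAdicComplete_maximalIdeal_padicCoeffIntegers p S
  have hpm := IwasawaH1CoeffExists.natCast_mem_maximalIdeal_padicCoeffIntegers p S
  obtain ⟨e, he0, he⟩ := exists_maximalIdeal_pow_eq_span_natCast S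
  -- coordinatewise `𝔪`-adic limits
  have hlim : ∀ i : Fin n, ∃ Li : padicCoeffIntegers S, ∀ k,
      f k i - Li ∈ IsLocalRing.maximalIdeal (padicCoeffIntegers S) ^ k := by
    intro i
    obtain ⟨Li, hLi⟩ := IsPrecomplete.prec (inferInstance : IsPrecomplete
      (IsLocalRing.maximalIdeal (padicCoeffIntegers S)) (padicCoeffIntegers S)) (f := fun k ↦ f k i)
      (fun {m n'} hmn' ↦ by
        obtain ⟨t, ht⟩ := exists_pow_smul_eq_sub_of_le S f hf hmn'
        rw [smodEq_smul_top_iff, ← neg_sub, neg_mem_iff, show f n' i - f m i = (f n' - f m) i from rfl,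
          ← ht, Pi.smul_apply, smul_eq_mul]
        exact Ideal.mul_mem_right _ _ (Ideal.pow_mem_pow hpm m))
    exact ⟨Li, fun k ↦ (smodEq_smul_top_iff _ k _ _).mp (hLi k)⟩
  choose L hL using hlim
  refine ⟨L, fun k ↦ ?_⟩
  -- at precision `k`, use the term `f (e k)`: `f (e k) - L ∈ 𝔪^{e k} = (p^k)` and `f (e k) - f k ∈ p^k`
  have hk : k ≤ e * k := Nat.le_mul_of_pos_left k he0
  obtain ⟨t, ht⟩ := exists_pow_smul_eq_sub_of_le S f hf hk
  have hcoord : ∀ i, ∃ s : padicCoeffIntegers S,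
      s * ((p : ℕ) : padicCoeffIntegers S) ^ k = f (e * k) i - L i := fun i ↦ by
    apply Ideal.mem_span_singleton'.mp
    rw [← Ideal.span_singleton_pow, ← he, ← pow_mul]
    exact hL i (e * k)
  choose s hs using hcoord
  refine ⟨s - t, funext fun i ↦ ?_⟩
  have hti := congr_fun ht i
  simp only [Pi.smul_apply, Pi.sub_apply, smul_eq_mul] at hti ⊢
  rw [mul_sub, mul_comm _ (s i), hs, hti]
  abel

/-- **`𝒪ⁿ` is `p`-adically separated:** `⋂_k p^k 𝒪ⁿ = 0` (Krull: `⋂ 𝔪^k = 0`, `p ∈ 𝔪`); the `hhaus` input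
of the tower engine. [cite: Matsumura1987, Thm. 8.10] -/
theorem eq_zero_of_forall_pow_natCast_smul (n : ℕ) (m : Fin n → padicCoeffIntegers S)
    (hm : ∀ k, ∃ t : Fin n → padicCoeffIntegers S, ((p : ℕ) : padicCoeffIntegers S) ^ k • t = m) :
    m = 0 := by
  haveI : IsLocalRing (padicCoeffIntegers S) := isLocalRing_padicCoeffIntegers S
  haveI := IwasawaH1CoeffExists.isAdicComplete_maximalIdeal_padicCoeffIntegers p S
  have hpm := IwasawaH1CoeffExists.natCast_mem_maximalIdeal_padicCoeffIntegers p S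
  funext i
  refine IsHausdorff.haus (inferInstance : IsHausdorff
    (IsLocalRing.maximalIdeal (padicCoeffIntegers S)) (padicCoeffIntegers S)) (m i) fun k ↦ ?_
  obtain ⟨t, ht⟩ := hm k
  rw [smodEq_smul_top_iff, sub_zero, ← congr_fun ht i, Pi.smul_apply, smul_eq_mul]
  exact Ideal.mul_mem_right _ _ (Ideal.pow_mem_pow hpm k)

end Ring

/-! ## §2 Polynomials over `𝒪`: a power of `p` in `(P, ω_n)`, or a common monic factor -/

section Polys

variable {p : ℕ} [Fact p.Prime] (S : Set (PadicAlgCl p)) [FiniteDimensional ℚ_[p] (padicCoeffField S)]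

omit [FiniteDimensional ℚ_[p] (padicCoeffField S)] in
/-- `ω_n = (X+1)^{p^n} − 1` is monic of positive degree `p^n`. [folklore] -/
private theorem monic_omega (n : ℕ) :
    ((X + 1 : (padicCoeffIntegers S)[X]) ^ p ^ n - 1).Monic ∧
      0 < ((X + 1 : (padicCoeffIntegers S)[X]) ^ p ^ n - 1).natDegree := by
  have hp : p.Prime := Fact.out
  have hm : p ^ n ≠ 0 := pow_ne_zero n hp.ne_zero
  have hmon : ((X + 1 : (padicCoeffIntegers S)[X]) ^ p ^ n).Monic := by
    rw [show (X + 1 : (padicCoeffIntegers S)[X]) = X + C 1 by rw [C_1]]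
    exact (monic_X_add_C 1).pow _
  have hdeg : ((X + 1 : (padicCoeffIntegers S)[X]) ^ p ^ n).natDegree = p ^ n := by
    rw [show (X + 1 : (padicCoeffIntegers S)[X]) = X + C 1 by rw [C_1], (monic_X_add_C 1).natDegree_pow,
      natDegree_X_add_C, mul_one]
  have hlt : (1 : (padicCoeffIntegers S)[X]).degree < ((X + 1 : (padicCoeffIntegers S)[X]) ^ p ^ n).degree := by
    rw [degree_one, degree_eq_natDegree hmon.ne_zero, hdeg]
    exact_mod_cast Nat.pos_of_ne_zero hm
  refine ⟨hmon.sub_of_left hlt, ?_⟩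
  rw [natDegree_sub_eq_left_of_natDegree_lt (by rw [natDegree_one, hdeg]; exact Nat.pos_of_ne_zero hm),
    hdeg]
  exact Nat.pos_of_ne_zero hm

omit [FiniteDimensional ℚ_[p] (padicCoeffField S)] in
/-- **Resultant dichotomy for a monic `P ∈ 𝒪[X]` of positive degree and `ω_n`:** either the ideal
`(P, ω_n) ⊆ 𝒪[X]` contains a power of `p` — `Res(P, ω_n) = U P + V ω_n` (Mathlib
`exists_mul_add_mul_eq_C_resultant`) is non-zero and every non-zero element of `𝒪` divides a power of `p`
— or `Res(P, ω_n) = 0`, i.e. (over the algebraically closed `ℚ̄_p`, both polynomials monic) `P` and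
`ω_n` have a common root `a ∈ ℚ̄_p`. [cite: Lang2002, IV §8 (the resultant)] -/
theorem exists_mul_add_mul_eq_C_pow_or_exists_root (P : (padicCoeffIntegers S)[X]) (hP : P.Monic)
    (hP0 : 0 < P.natDegree) (n : ℕ) :
    (∃ (U V : (padicCoeffIntegers S)[X]) (k : ℕ),
        U * P + V * ((X + 1 : (padicCoeffIntegers S)[X]) ^ p ^ n - 1) =
          C (((p : ℕ) : padicCoeffIntegers S) ^ k)) ∨
      ∃ a : PadicAlgCl p, aeval a P = 0 ∧ aeval a ((X + 1 : (padicCoeffIntegers S)[X]) ^ p ^ n - 1) = 0 := by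
  set ω : (padicCoeffIntegers S)[X] := (X + 1 : (padicCoeffIntegers S)[X]) ^ p ^ n - 1 with hωdef
  obtain ⟨hω, hω0⟩ := monic_omega S n
  obtain ⟨U', V', -, -, hUV⟩ :=
    exists_mul_add_mul_eq_C_resultant P ω le_rfl le_rfl (Or.inl hP0.ne')
  set r := P.resultant ω P.natDegree ω.natDegree with hr
  by_cases hr0 : r = 0
  · right
    -- over `ℚ̄_p` the resultant vanishes, so the monic polynomials have a common root
    let φ : padicCoeffIntegers S →+* PadicAlgCl p := algebraMap (padicCoeffIntegers S) (PadicAlgCl p)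
    have hres : (P.map φ).resultant (ω.map φ) = 0 := by
      have h := resultant_map_map (f := P) (g := ω) (m := P.natDegree) (n := ω.natDegree) φ
      rw [← hr, hr0, map_zero, ← hP.natDegree_map φ, ← hω.natDegree_map φ] at h
      exact h
    rw [resultant_eq_zero_iff, Polynomial.isCoprime_iff_aeval_ne_zero_of_isAlgClosed
      (k := PadicAlgCl p) (PadicAlgCl p) (P.map φ) (ω.map φ)] at hres
    obtain ⟨-, hnc⟩ := hres
    push Not at hnc
    obtain ⟨a, haP, haω⟩ := hnc
    refine ⟨a, ?_, ?_⟩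
    · rwa [Polynomial.aeval_map_algebraMap] at haP
    · rwa [Polynomial.aeval_map_algebraMap] at haω
  · left
    obtain ⟨k, hk⟩ := exists_pow_natCast_mem_span S hr0
    obtain ⟨b, hb⟩ := Ideal.mem_span_singleton'.mp hk
    refine ⟨C b * U', C b * V', k, ?_⟩
    rw [mul_assoc, mul_assoc, ← mul_add, mul_comm U', mul_comm V', hUV, ← C_mul, hb]

/-- **A common root yields a common monic factor over `𝒪`:** if `a ∈ ℚ̄_p` is a root of `P ∈ 𝒪[X]` and of
`ω_n`, then `Q = minpoly_𝒪(a)` (monic, positive degree; `a` is integral as a root of the monic `ω_n`,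
and `𝒪` is integrally closed) divides both `P` and `ω_n` in `𝒪[X]` (`minpoly.isIntegrallyClosed_dvd`).
[cite: Lang2002, IV §2 and VII §1 (Gauss lemma; integral closure)] -/
theorem exists_monic_dvd_of_root (P : (padicCoeffIntegers S)[X]) (n : ℕ) (a : PadicAlgCl p)
    (haP : aeval a P = 0) (haω : aeval a ((X + 1 : (padicCoeffIntegers S)[X]) ^ p ^ n - 1) = 0) :
    ∃ Q P₁ W : (padicCoeffIntegers S)[X], Q.Monic ∧ 0 < Q.natDegree ∧ P = Q * P₁ ∧
      ((X + 1 : (padicCoeffIntegers S)[X]) ^ p ^ n - 1) = Q * W := by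
  haveI : IsPrincipalIdealRing (padicCoeffIntegers S) := isPrincipalIdealRing_padicCoeffIntegers S
  haveI : Module.IsTorsionFree (padicCoeffIntegers S) (PadicAlgCl p) := by
    refine ⟨fun r hr x y hxy ↦ ?_⟩
    have hr0 : (r : PadicAlgCl p) ≠ 0 := fun h ↦ hr.ne_zero (Subtype.ext h)
    have hxy' : (r : PadicAlgCl p) * x = (r : PadicAlgCl p) * y := hxy
    exact mul_left_cancel₀ hr0 hxy'
  obtain ⟨hω, -⟩ := monic_omega S n
  have hint : IsIntegral (padicCoeffIntegers S) a := ⟨_, hω, by rwa [← aeval_def]⟩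
  refine ⟨minpoly (padicCoeffIntegers S) a, ?_⟩
  obtain ⟨P₁, hP₁⟩ := minpoly.isIntegrallyClosed_dvd hint haP
  obtain ⟨W, hW⟩ := minpoly.isIntegrallyClosed_dvd hint haω
  exact ⟨P₁, W, minpoly.monic hint, minpoly.natDegree_pos hint, hP₁, hW⟩

end Polys

end IwasawaH1CoeffTorsionFree

end Literature.NumberTheory.EllipticCurves.Kato2004

end
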